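import Summits.HodgeConjecture.HodgeConjecture.Theorems.F0P3cStCharTSUpTrEmbFamily          -- ★ (N2b′) p852417: the trichotomy kit on `ι_v(γ₀)` (`invariants_of_norm_one_root`, type (1)∕(2) class-count files, block frame of `ι_v`)
import Summits.HodgeConjecture.HodgeConjecture.Theorems.F0P3cStCharTSEllCartanCompactH     -- ★ (H1) F-B′ p852403: `isCompact_centralizer_iff_not_mem_hyperbolicSet_H` (+ ★ (B2) `endoEmbLocal_mem_hyperbolicSet_of_isRoot`)
import Literature.NumberTheory.Rogawski1990.EndoscopicStableTwistAutomorphism               -- ★ (H6a′) p852426: `exists_stableTwistAut` (the `H_v`-class count `2 ∕ 1` by type)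
import Literature.NumberTheory.Rogawski1990.LocalStableClassesNonsplitRankTwoIrreducible    -- ★ B-p14: `isConj_of_isStablyConj_of_irreducible_rankTwo`
import Literature.NumberTheory.Rogawski1990.UnitStableOrbitalIntegralIrredOneClass          -- ★ `adelicForm_antidiagTwo_local_hermitian`, `isUnit_det_adelicForm_antidiagTwo_local`
import HarnessLib

/-!
# (E6) «INDEX TWO»: over a compact Cartan subgroup of `H_v`, the `G`-classes over `ι_v(γ₀)` are TWICE the `H_v`-classes in the stable class of `γ₀` — `n T = 2 · m T`
(Rogawski 1990, §3.6 Lemma 3.6.1 p. 31 «`𝓔_H(T∕F) ↪ 𝓔_G(T∕F)` has index two … `|𝔇_H(T∕F)| = 2|𝔇(T∕F)|`»; §3.5 Prop. 3.5.2 (c) p. 29; §12.5 Prop. 12.5.2 p. 185)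

Cell `pub/hodgecm-mathlib`, crux H413 = `stmt-HodgeConjecture-24833`; ROAD «ELL-INNER» (charter-in-principle LEAD F0P3a-plan (g15) T14-40∕T14-44; map owner ∕ dealer LH6-p03 (g7),
CENSUS «1252 ∕ ELL-INNER» v1 06afd1d3d7b1895d, brick **(E6) INDEX TWO**, offered 20:09:57Z to the (H6a′) lineage; hand F0P3a-p09 (g11)).  THEOREMS ONLY (no definition, no instance,
no notation, no named fact, no `sorry`); lane `--kind proof --supports stmt-HodgeConjecture-24833 --as helper`.  Consumer BY NAME: (E8) «ELL-INNER ASSEMBLY» (F0P3a-p06 (g23),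
sigsheet of record 2491f5c6fae33558) binder `hnm : ∀ T ∈ SH, n T = 2 * m T`, in its own letters `SH n γc eT heT hexh hinj hZ hKH m hclasses`.
HONEST LABEL: count-neutral banked brick (no block consequent moves before a ★ rider); HC_CM is proved only modulo the printed citations until rung 0 closes.

THE MATHEMATICS.  Let `v` be non-split, `γ₀ ∈ H_v = U(Φ₂)(L⁺_v) × U(Φ₁)(L⁺_v)` `G`-regular with COMPACT centraliser `T = Z_H(γ₀)`.  By the trichotomy of `χ_{γ₀.1}` over `E_v`
(★ `eigenframe_trichotomy_of_separable`): the split case is excluded by compactness (a root `a` of `χ_{γ₀.1}` with `σ(a) a ≠ 1` puts `ι_v(γ₀)` in the hyperbolic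
set `Ω`, ★ `endoEmbLocal_mem_hyperbolicSet_of_isRoot`, contradicting ★ `isCompact_centralizer_iff_not_mem_hyperbolicSet_H`); in EIGENFRAME TYPE (1) the `G`-classes over
`ι_v(γ₀)` number `4` (★ `ncard_conjClassesIn_eq_four_of_charpoly`: `charpoly ι_v(γ₀) = (X−d₀)(X−d₁)(X−u)`, three distinct norm-one roots) and the `H_v`-classes in the stable
class of `γ₀` number `2` (★ (H6a′) `exists_stableTwistAut`: `{⟦γ₀⟧, ⟦e γ₀⟧}` with `e γ₀ ≁ γ₀`); in TYPE (2) (`χ_{γ₀.1}` irreducible) they number `2` (★ `ncard_conjClassesIn_eq_two` on the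
block frame of `ι_v`, ★ `mul_eq_mul_reindex_fromBlocks_of_conj_endoEmbLocal_eq`) and `1` (★ `isConj_of_isStablyConj_of_irreducible_rankTwo`).  Hence
**`#{G-classes over ι_v(γ₀)} = 2 · #{H_v-classes ∼_st γ₀}`** [L. 3.6.1].  §3 reads this count through the (E8) binders: the `Fin (n T)`-family of embeddings
`eT T i` is a transversal of the `G`-classes over `ι_v(γ₀)` at `s = γ₀` (`heT hexh hinj`), and `hclasses` gives a transversal of size `m T` of the `H_v`-classes.

* §1 generic finite bookkeeping: `ncard_setOf_out_eq_of_fin_transversal`, `ncard_setOf_out_eq_card_of_finset_transversal`.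
* §2 `ncard_normPairClasses_eq_two_mul_ncard_stableClasses` — the pointwise count `= 2 ·` at a `G`-regular `γ₀` with compact centraliser.
* §3 **`index_two_of_letters`** — `∀ T ∈ SH, n T = 2 * m T` in the (E8) letters.

## References
* [Rogawski1990] J. D. Rogawski, *Automorphic Representations of Unitary Groups in Three Variables*, Ann. of Math. Stud. 123 (1990), §3.5 Prop. 3.5.2 (c) p. 29,
  §3.6 Lemma 3.6.1 p. 31, §12.5 Prop. 12.5.2 p. 185.
* [Kottwitz1986] R. E. Kottwitz, *Stable trace formula: elliptic singular terms*, Math. Ann. 275 (1986), §7.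
-/

set_option autoImplicit false
-- the mandated namespace has the single-problem summit's repeated segment (`HodgeConjecture.HodgeConjecture`)
set_option linter.dupNamespace false

noncomputable section

open NumberField IsDedekindDomain Matrix Polynomial
open scoped MatrixGroups
open Literature.NumberTheory.Rogawski1990 Literature.NumberTheory.Automorphic Literature.NumberTheory.Automorphic.UnitaryGroup
open Literature.AlgebraicGeometry.ShimuraVarieties (unitaryGroup)
open Summit.HodgeConjecture.HodgeConjecture.Cruxes.H413.F0P3cStCharTSFibreRealise (invariants_of_norm_one_root)
open Summit.HodgeConjecture.HodgeConjecture.Cruxes.H413.F0P3cStCharTSEllCartanCompactH (isCompact_centralizer_iff_not_mem_hyperbolicSet_H)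
open Summit.HodgeConjecture.HodgeConjecture.Cruxes.H413.F0P3cStCharTSStableInvariantsH (endoEmbLocal_mem_hyperbolicSet_of_isRoot)

namespace Summit.HodgeConjecture.HodgeConjecture.Cruxes.H413.F0P3cStCharTSEllInnerIndexTwo

/-! ## §1 Generic: the number of conjugacy classes met by a finite transversal -/

section Generic

variable {G : Type*} [Group G]

/-- `⟦out c⟧ = c`. [folklore] -/
private theorem mk_out (c : ConjClasses G) : ConjClasses.mk (Quotient.out c) = c := by
  rw [← ConjClasses.quotient_mk_eq_mk, Quotient.out_eq]

/-- **A `Fin n`-transversal counts the classes**: if `P` is a class function, `g : Fin n → G` takes values in `P`, is pairwise non-conjugate, and every element of `P` is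
conjugate to some `g i`, then the conjugacy classes meeting `P` number exactly `n`. [cite: Rogawski1990, §3.5 Prop. 3.5.2 (c) p. 29] -/
theorem ncard_setOf_out_eq_of_fin_transversal (P : G → Prop) (hP : ∀ a b : G, IsConj a b → P a → P b) {n : ℕ} (g : Fin n → G)
    (hg : ∀ i, P (g i)) (hinj : ∀ i j : Fin n, i ≠ j → ¬ IsConj (g i) (g j)) (hexh : ∀ a, P a → ∃ i, IsConj (g i) a) :
    {c : ConjClasses G | P (Quotient.out c)}.ncard = n := by
  classical
  have hbij : Function.Bijective (fun i : Fin n => (⟨ConjClasses.mk (g i), hP _ _ (by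
      rw [← ConjClasses.mk_eq_mk_iff_isConj, mk_out]) (hg i)⟩ : {c : ConjClasses G | P (Quotient.out c)})) := by
    constructor
    · intro i j hij
      by_contra hne
      exact hinj i j hne (ConjClasses.mk_eq_mk_iff_isConj.1 (congrArg Subtype.val hij))
    · rintro ⟨c, hc⟩
      obtain ⟨i, hi⟩ := hexh _ hc
      refine ⟨i, Subtype.ext ?_⟩
      show ConjClasses.mk (g i) = c
      rw [ConjClasses.mk_eq_mk_iff_isConj.2 hi, mk_out]
  have h := Nat.card_eq_of_bijective _ hbij
  rw [Nat.card_eq_fintype_card, Fintype.card_fin, Nat.card_coe_set_eq] at h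
  exact h.symm

/-- **A `Finset`-transversal counts the classes** (the `hclasses` letters of ★ (N5) `StableFibre.weighted_fibre_sum_eq`): for a relation `st a ·` closed under conjugation, a finite
`C` of `st a`-elements, pairwise non-conjugate, to which every `st a`-element is conjugate, has `C.card` = the number of conjugacy classes in `{y | st a y}`.
[cite: Rogawski1990, §3.5 Prop. 3.5.2 (c) p. 29] -/
theorem ncard_setOf_out_eq_card_of_finset_transversal (st : G → G → Prop) (a : G) (hconj : ∀ b b' : G, IsConj b b' → st a b → st a b')
    (C : Finset G) (hCst : ∀ x ∈ C, st a x) (hCinj : ∀ x ∈ C, ∀ y ∈ C, IsConj x y → x = y) (hCexh : ∀ y : G, st a y → ∃ x ∈ C, IsConj y x) :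
    {c : ConjClasses G | st a (Quotient.out c)}.ncard = C.card := by
  classical
  have hset : {c : ConjClasses G | st a (Quotient.out c)} = (fun x => ConjClasses.mk x) '' (C : Set G) := by
    ext c
    constructor
    · intro hc
      obtain ⟨x, hx, hcx⟩ := hCexh _ hc
      refine ⟨x, hx, ?_⟩
      rw [← mk_out c, ConjClasses.mk_eq_mk_iff_isConj]
      exact hcx.symm
    · rintro ⟨x, hx, rfl⟩
      exact hconj _ _ (by rw [← ConjClasses.mk_eq_mk_iff_isConj, mk_out]) (hCst x hx)
  have hinjOn : Set.InjOn (fun x => ConjClasses.mk x) (C : Set G) := fun x hx y hy hxy =>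
    hCinj x hx y hy (ConjClasses.mk_eq_mk_iff_isConj.1 hxy)
  rw [hset, hinjOn.ncard_image, Set.ncard_coe_finset]

end Generic

/-! ## §2 The pointwise count at a `G`-regular `γ₀ ∈ H_v` with compact centraliser -/

section CM

variable (L : Type) [Field L] [NumberField L] [IsCMField L] (v : HeightOneSpectrum (𝓞 ↥(maximalRealSubfield L)))

/-- A match of `γ₀` stays a match under `G`-conjugation (local copy of ★ (P3) `isLocalNormPair_of_isConj_right`). [cite: Rogawski1990, §4.3 p. 43] -/
private theorem isLocalNormPair_of_isConj_right' (a : ((UnitaryGroup.cmDatum L 2 (Matrix.of fun i j : Fin 2 => if i.val + j.val + 1 = 2 then (1 : L) else 0)).Local v × (UnitaryGroup.cmDatum L 1 (Matrix.of fun i j : Fin 1 => if i.val + j.val + 1 = 1 then (1 : L) else 0)).Local v)) {g g' : Gqs L v} (hgg' : IsConj g g') (h : IsLocalNormPair L (qsForm L) v a g) :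
    IsLocalNormPair L (qsForm L) v a g' := by
  obtain ⟨c, hc⟩ := isConj_iff.1 hgg'
  have hval : (c : Gqs L v).val * g.val * ((c : Gqs L v).val)⁻¹ = g'.val := by
    rw [← hc]; rfl
  exact IsConj.trans h (isConj_iff.2 ⟨(c : Gqs L v).val, hval⟩)

/-- The `G`-classes over `ι_v(γ₀)` ARE the classes of the local stable class of `ι_v(γ₀)` (★ `conjClassesIn`; `γ_H → γ` is `GL₃`-conjugacy of `ι_v(γ_H)` with `γ`).
[cite: Rogawski1990, §4.3 p. 43; §3.1 p. 19] -/
theorem setOf_isLocalNormPair_out_eq_conjClassesIn (γ₀ : ((UnitaryGroup.cmDatum L 2 (Matrix.of fun i j : Fin 2 => if i.val + j.val + 1 = 2 then (1 : L) else 0)).Local v × (UnitaryGroup.cmDatum L 1 (Matrix.of fun i j : Fin 1 => if i.val + j.val + 1 = 1 then (1 : L) else 0)).Local v)) :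
    {c : ConjClasses (Gqs L v) | IsLocalNormPair L (qsForm L) v γ₀ (Quotient.out c)} =
      conjClassesIn (conjLocal L (IsCMField.complexConj L) v) (cmLocalForm L 3 v)
        ⟨((endoEmbLocal L v γ₀).val : GL (Fin 3) (LocalRing L v)), (endoEmbLocal L v γ₀).2⟩ := by
  ext c
  have hmk : ConjClasses.mk (Quotient.out c) = c := mk_out c
  constructor
  · intro hc
    have hst : IsStablyConj (conjLocal L (IsCMField.complexConj L) v) (cmLocalForm L 3 v)
        ⟨((endoEmbLocal L v γ₀).val : GL (Fin 3) (LocalRing L v)), (endoEmbLocal L v γ₀).2⟩ (Quotient.out c) := isStablyConj_iff.2 (isConj_iff.1 hc)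
    have h := mk_mem_conjClassesIn_iff.2 hst
    exact Eq.subst (motive := fun x : ConjClasses (Gqs L v) => x ∈ conjClassesIn (conjLocal L (IsCMField.complexConj L) v) (cmLocalForm L 3 v)
      ⟨((endoEmbLocal L v γ₀).val : GL (Fin 3) (LocalRing L v)), (endoEmbLocal L v γ₀).2⟩) hmk h
  · intro hc
    have hc' : ConjClasses.mk (Quotient.out c) ∈ conjClassesIn (conjLocal L (IsCMField.complexConj L) v) (cmLocalForm L 3 v)
        ⟨((endoEmbLocal L v γ₀).val : GL (Fin 3) (LocalRing L v)), (endoEmbLocal L v γ₀).2⟩ :=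
      Eq.subst (motive := fun x : ConjClasses (Gqs L v) => x ∈ conjClassesIn (conjLocal L (IsCMField.complexConj L) v) (cmLocalForm L 3 v)
        ⟨((endoEmbLocal L v γ₀).val : GL (Fin 3) (LocalRing L v)), (endoEmbLocal L v γ₀).2⟩) hmk.symm hc
    have hst := mk_mem_conjClassesIn_iff.1 hc'
    exact isConj_iff.2 (isStablyConj_iff.1 hst)

/-- **THE POINTWISE INDEX-TWO COUNT.**  At a non-split `v`, for a `G`-regular `γ₀ ∈ H_v` with COMPACT centraliser `Z_H(γ₀)`:
`#{G-classes γ : γ₀ → γ} = 2 · #{H_v-classes in the stable class of γ₀}` — `4 = 2·2` in eigenframe type (1), `2 = 2·1` in type (2); the split type is excluded by compactness.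
[cite: Rogawski1990, §3.6 Lemma 3.6.1 p. 31; §3.5 Prop. 3.5.2 (c) p. 29] [cite: Kottwitz1986, §7] -/
theorem ncard_normPairClasses_eq_two_mul_ncard_stableClasses (hns : ∀ w : PlacesOver L v, IsCMField.complexConj L • w.1 = w.1)
    (γ₀ : ((UnitaryGroup.cmDatum L 2 (Matrix.of fun i j : Fin 2 => if i.val + j.val + 1 = 2 then (1 : L) else 0)).Local v × (UnitaryGroup.cmDatum L 1 (Matrix.of fun i j : Fin 1 => if i.val + j.val + 1 = 1 then (1 : L) else 0)).Local v)) (hreg : IsLocalGRegular L v γ₀)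
    (hcpt : IsCompact ((Subgroup.centralizer ({γ₀} : Set ((UnitaryGroup.cmDatum L 2 (Matrix.of fun i j : Fin 2 => if i.val + j.val + 1 = 2 then (1 : L) else 0)).Local v × (UnitaryGroup.cmDatum L 1 (Matrix.of fun i j : Fin 1 => if i.val + j.val + 1 = 1 then (1 : L) else 0)).Local v)) : Subgroup ((UnitaryGroup.cmDatum L 2 (Matrix.of fun i j : Fin 2 => if i.val + j.val + 1 = 2 then (1 : L) else 0)).Local v × (UnitaryGroup.cmDatum L 1 (Matrix.of fun i j : Fin 1 => if i.val + j.val + 1 = 1 then (1 : L) else 0)).Local v)) : Set ((UnitaryGroup.cmDatum L 2 (Matrix.of fun i j : Fin 2 => if i.val + j.val + 1 = 2 then (1 : L) else 0)).Local v × (UnitaryGroup.cmDatum L 1 (Matrix.of fun i j : Fin 1 => if i.val + j.val + 1 = 1 then (1 : L) else 0)).Local v))) :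
    {c : ConjClasses (Gqs L v) | IsLocalNormPair L (qsForm L) v γ₀ (Quotient.out c)}.ncard =
      2 * {d : ConjClasses ((UnitaryGroup.cmDatum L 2 (Matrix.of fun i j : Fin 2 => if i.val + j.val + 1 = 2 then (1 : L) else 0)).Local v × (UnitaryGroup.cmDatum L 1 (Matrix.of fun i j : Fin 1 => if i.val + j.val + 1 = 1 then (1 : L) else 0)).Local v) | IsLocalStablyConjH L v γ₀ (Quotient.out d)}.ncard := by
  classical
  obtain ⟨w⟩ := (inferInstance : Nonempty (PlacesOver L v))
  have hw := hns w
  obtain ⟨δ₁, hcδ, hδ⟩ := Literature.NumberTheory.Weil1982.UnitaryFinTopForm.exists_complexConj_eq_neg_ne_zero L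
  -- the (H6a′) twist automorphism: the `H_v`-class set of `γ₀` is `{⟦γ₀⟧, ⟦e γ₀⟧}`
  obtain ⟨e, -, -, h2, -, -, h5, -, h7⟩ := exists_stableTwistAut L v w hw
  have hHset := h7 γ₀ hreg
  -- no hyperbolic root (compactness)
  have hΩ : endoEmbLocal L v γ₀ ∉ F0P3cStCharTSTorusDefs.hyperbolicSet L v :=
    (isCompact_centralizer_iff_not_mem_hyperbolicSet_H L v hns γ₀ hreg).1 hcpt
  -- the `G`-side set is the class set of the local stable class of `ι_v(γ₀)`
  rw [setOf_isLocalNormPair_out_eq_conjClassesIn L v γ₀]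
  letI : Field (LocalRing L v) :=
    (Liu2021.LemD1IndexedNonVacuityNonsplitPlace.isField_localRing_of_nonsplit L v (IsCMField.complexConj L) hcδ hδ w hw).toField
  -- the local hermitian data of `Φ₃` and `Φ₂`
  have hH := map_conjLocal_transpose_localForm L 3 (Matrix.of fun i j : Fin 3 => if i.val + j.val + 1 = 3 then (1 : L) else 0) v
    (antidiagOne_isHermitian L 3)
  have hHd := isUnit_det_localForm L 3 (Matrix.of fun i j : Fin 3 => if i.val + j.val + 1 = 3 then (1 : L) else 0) v
    (isUnit_antidiagOne_det L 3).ne_zero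
  have hH2 := adelicForm_antidiagTwo_local_hermitian L v
  have hH2d := isUnit_det_adelicForm_antidiagTwo_local L v
  -- notation
  set σ := conjLocal L (IsCMField.complexConj L) v with hσ
  set y : Gqs L v := endoEmbLocal L v γ₀ with hy
  set Y : Matrix (Fin 3) (Fin 3) (LocalRing L v) := (y.val : GL (Fin 3) (LocalRing L v)).val with hY
  set u : LocalRing L v := finGammaTwo L v γ₀ with hu
  set q : Polynomial (LocalRing L v) := finCharpolyTwo L v γ₀ with hq
  have hσσ : ∀ x, σ (σ x) = x := conjLocal_conjLocal_cm L v
  have hu1 : σ u * u = 1 := conjLocal_finGammaTwo_mul_finGammaTwo L v γ₀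
  have hchar : Y.charpoly = q * (X - C u) := charpoly_endoEmbLocal L v γ₀
  have hsep : Y.charpoly.Separable := hreg
  have hroot : Y.charpoly.IsRoot u := by
    rw [hchar, IsRoot, eval_mul, eval_sub, eval_X, eval_C, sub_self, mul_zero]
  obtain ⟨hd, ht, hfac⟩ := invariants_of_norm_one_root L v y hroot hu1
  set t : LocalRing L v := Y.trace - u with ht'
  set d : LocalRing L v := Y.det * σ u with hd'
  have hqm : q.Monic := Matrix.charpoly_monic _
  have hq2 : q = X ^ 2 - C t * X + C d := by
    have h := hfac.trans hchar
    exact (mul_right_cancel₀ (X_sub_C_ne_zero u) h).symm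
  have hd0 : d ≠ 0 := fun h0 => by rw [h0, mul_zero] at hd; exact zero_ne_one hd
  by_cases hex : ∃ a : LocalRing L v, q.IsRoot a
  · obtain ⟨a, ha⟩ := hex
    set b : LocalRing L v := t - a with hb
    have hab : a * b = d := by
      have h := ha
      rw [hq2, IsRoot, eval_add, eval_sub, eval_pow, eval_X, eval_mul, eval_C, eval_X, eval_C] at h
      rw [hb]; linear_combination -h
    have hqab : q = (X - C a) * (X - C b) := by
      have h1' : C t = C a + C b := by rw [← C_add, hb, add_sub_cancel]
      have h2' : C d = C a * C b := by rw [← C_mul, hab]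
      rw [hq2, h1', h2']; ring
    have hchar3 : Y.charpoly = (X - C a) * (X - C b) * (X - C u) := by rw [hchar, hqab]
    have hsep3 : ((X - C a) * (X - C b) * (X - C u)).Separable := by rw [← hchar3]; exact hsep
    have hinj3 : Function.Injective ![a, b, u] := by
      have h3 : ((X - C a) * (X - C b) * (X - C u)) = ∏ i : Fin 3, (X - C (![a, b, u] i)) := by
        rw [Fin.prod_univ_three]; rfl
      rw [h3] at hsep3
      exact separable_prod_X_sub_C_iff.1 hsep3
    have hab' : a ≠ b := fun h0 => absurd (@hinj3 0 1 (by simp [h0])) (by decide)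
    by_cases hna : σ a * a = 1
    · -- TYPE (1): four `G`-classes, two `H_v`-classes
      have hnb : σ b * b = 1 := by
        have h1 : σ d * d = 1 := hd
        rw [← hab, map_mul] at h1
        have h2' : σ b * b * (σ a * a) = 1 := by linear_combination h1
        rwa [hna, mul_one] at h2'
      have hchar' : Y.charpoly = ∏ i : Fin 3, (X - C (![a, b, u] i)) := by rw [hchar3, Fin.prod_univ_three]; rfl
      have hnorm : ∀ i, σ (![a, b, u] i) * ![a, b, u] i = 1 := by
        intro i; fin_cases i
        · exact hna
        · exact hnb
        · exact hu1
      have hG : (conjClassesIn σ (cmLocalForm L 3 v) ⟨(y.val : GL (Fin 3) (LocalRing L v)), y.2⟩).ncard = 4 :=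
        ncard_conjClassesIn_eq_four_of_charpoly L v (IsCMField.complexConj L) hcδ hδ w hw hH hHd y.2 ![a, b, u] hinj3 hnorm hchar'
      -- the `H_v`-side: an eigenframe of `γ₀.1` with the norm-one diagonal `(a, b)`
      have hinj2 : Function.Injective ![a, b] := by
        intro i j h
        fin_cases i <;> fin_cases j
        · rfl
        · exact absurd (by simpa using h) hab'
        · exact absurd (by simpa using h) (Ne.symm hab')
        · rfl
      have hchar2 : (γ₀.1.val : GL (Fin 2) (LocalRing L v)).val.charpoly = ∏ i : Fin 2, (X - C (![a, b] i)) := by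
        rw [Fin.prod_univ_two]
        show finCharpolyTwo L v γ₀ = _
        rw [← hq, hqab]; rfl
      obtain ⟨P, hP⟩ := exists_eigenframe_of_charpoly_eq_prod (γ₀.1.val : GL (Fin 2) (LocalRing L v)) ![a, b] hinj2 hchar2
      have hnorm2 : ∀ i, σ (![a, b] i) * ![a, b] i = 1 := by
        intro i; fin_cases i
        · exact hna
        · exact hnb
      have hreg1 : IsRegularElt (γ₀.1.val : GL (Fin 2) (LocalRing L v)) := (isRegularElt_fst_snd_of_isLocalGRegular L v γ₀ hreg).1
      have hnc : ¬ IsConj γ₀ (e γ₀) := h5 γ₀ P _ hreg1 hP hnorm2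
      have hH' : {d : ConjClasses ((UnitaryGroup.cmDatum L 2 (Matrix.of fun i j : Fin 2 => if i.val + j.val + 1 = 2 then (1 : L) else 0)).Local v × (UnitaryGroup.cmDatum L 1 (Matrix.of fun i j : Fin 1 => if i.val + j.val + 1 = 1 then (1 : L) else 0)).Local v) | IsLocalStablyConjH L v γ₀ (Quotient.out d)}.ncard = 2 := by
        rw [hHset, Set.ncard_pair (fun h => hnc (ConjClasses.mk_eq_mk_iff_isConj.1 h))]
      rw [hH']
      exact hG.trans (by norm_num)
    · -- SPLIT: excluded — the root `a` with `σ a · a ≠ 1` puts `ι_v(γ₀)` in `Ω`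
      exact absurd (endoEmbLocal_mem_hyperbolicSet_of_isRoot L v hns hreg (α := a) ha (by rwa [mul_comm])) hΩ
  · -- TYPE (2): two `G`-classes, one `H_v`-class
    have hroots : q.roots = 0 := by
      refine Multiset.eq_zero_of_forall_notMem fun a ha => hex ⟨a, ?_⟩
      exact (mem_roots hqm.ne_zero).1 ha
    have hqdeg : q.natDegree = 2 := by rw [hq]; unfold finCharpolyTwo; exact Matrix.charpoly_natDegree_eq_dim _
    have hirr : Irreducible q := (hqm.irreducible_iff_roots_eq_zero_of_degree_le_three (by omega) (by omega)).2 hroots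
    have hPb := mul_eq_mul_reindex_fromBlocks_of_conj_endoEmbLocal_eq L (Matrix.of fun i j : Fin 3 => if i.val + j.val + 1 = 3 then (1 : L) else 0) γ₀
      (b := y) (c := 1) (by rw [one_mul, inv_one, mul_one])
    rw [Units.val_one] at hPb
    have hG : (conjClassesIn σ (cmLocalForm L 3 v) ⟨(y.val : GL (Fin 3) (LocalRing L v)), y.2⟩).ncard = 2 :=
      ncard_conjClassesIn_eq_two L v (IsCMField.complexConj L) hcδ hδ endoPerm w hw hH hHd y.2 (P := 1) hPb hirr
    -- the `H_v`-side: every stable conjugate of `γ₀` is conjugate to it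
    have hconj : IsConj γ₀ (e γ₀) := by
      have hst := h2 γ₀
      have hirr1 : Irreducible (γ₀.1.val : GL (Fin 2) (LocalRing L v)).val.charpoly := by
        have h : (γ₀.1.val : GL (Fin 2) (LocalRing L v)).val.charpoly = q := by rw [hq]; rfl
        rw [h]; exact hirr
      have hc1 : IsConj γ₀.1 (e γ₀).1 := by
        have h := isConj_of_isStablyConj_of_irreducible_rankTwo L v (IsCMField.complexConj L) hcδ hδ w hw hH2 hH2d γ₀.1.2 hirr1 _ hst.1
        exact h
      have hc2 : γ₀.2 = (e γ₀).2 := eq_of_isStablyConj_rankOne (conjLocal L (IsCMField.complexConj L) v) _ hst.2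
      obtain ⟨c, hc⟩ := isConj_iff.1 hc1
      exact isConj_iff.2 ⟨(c, 1), Prod.ext (by simpa using hc) (by simpa using hc2)⟩
    have hH' : {d : ConjClasses ((UnitaryGroup.cmDatum L 2 (Matrix.of fun i j : Fin 2 => if i.val + j.val + 1 = 2 then (1 : L) else 0)).Local v × (UnitaryGroup.cmDatum L 1 (Matrix.of fun i j : Fin 1 => if i.val + j.val + 1 = 1 then (1 : L) else 0)).Local v) | IsLocalStablyConjH L v γ₀ (Quotient.out d)}.ncard = 1 := by
      rw [hHset, (ConjClasses.mk_eq_mk_iff_isConj.2 hconj).symm, Set.pair_eq_singleton, Set.ncard_singleton]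
    rw [hH']
    exact hG.trans (by norm_num)

/-! ## §3 In the (E8) letters: `n T = 2 · m T` on the compact Cartan system `SH` -/

/-- **(E6) «INDEX TWO» IN THE ASSEMBLY'S LETTERS.**  For the `H`-Cartan system `SH` (compact members `T = Z_H(γ₀)`, `γ₀` `G`-regular: `hZ`, `hKH`), the `Fin (n T)`-family of
embeddings `eT T i : T ≃ₜ* Z_G(γc T i)` matching along the torus (`heT`), exhaustive and pairwise non-conjugate on the `G`-regular set (`hexh`, `hinj`), and the `H_v`-class
transversals of size `m T` (`hclasses`): **`n T = 2 · m T` for every `T ∈ SH`** — Lemma 3.6.1 «`|𝔇_H(T∕F)| = 2 |𝔇(T∕F)|`» read at `γ₀`.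
[cite: Rogawski1990, §3.6 Lemma 3.6.1 p. 31; §12.5 Prop. 12.5.2 p. 185] -/
theorem index_two_of_letters (hns : ∀ w : PlacesOver L v, IsCMField.complexConj L • w.1 = w.1)
    (SH : Finset (Subgroup ((UnitaryGroup.cmDatum L 2 (Matrix.of fun i j : Fin 2 => if i.val + j.val + 1 = 2 then (1 : L) else 0)).Local v × (UnitaryGroup.cmDatum L 1 (Matrix.of fun i j : Fin 1 => if i.val + j.val + 1 = 1 then (1 : L) else 0)).Local v))) (n : Subgroup ((UnitaryGroup.cmDatum L 2 (Matrix.of fun i j : Fin 2 => if i.val + j.val + 1 = 2 then (1 : L) else 0)).Local v × (UnitaryGroup.cmDatum L 1 (Matrix.of fun i j : Fin 1 => if i.val + j.val + 1 = 1 then (1 : L) else 0)).Local v) → ℕ)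
    (γc : (T : Subgroup ((UnitaryGroup.cmDatum L 2 (Matrix.of fun i j : Fin 2 => if i.val + j.val + 1 = 2 then (1 : L) else 0)).Local v × (UnitaryGroup.cmDatum L 1 (Matrix.of fun i j : Fin 1 => if i.val + j.val + 1 = 1 then (1 : L) else 0)).Local v)) → Fin (n T) → Gqs L v)
    (eT : (T : Subgroup ((UnitaryGroup.cmDatum L 2 (Matrix.of fun i j : Fin 2 => if i.val + j.val + 1 = 2 then (1 : L) else 0)).Local v × (UnitaryGroup.cmDatum L 1 (Matrix.of fun i j : Fin 1 => if i.val + j.val + 1 = 1 then (1 : L) else 0)).Local v)) → (i : Fin (n T)) → (↥T ≃ₜ* ↥(Subgroup.centralizer ({γc T i} : Set (Gqs L v)))))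
    (heT : ∀ T ∈ SH, ∀ (i : Fin (n T)) (s : ↥T), IsLocalNormPair L (qsForm L) v s.1 ((eT T i s : ↥(Subgroup.centralizer ({γc T i} : Set (Gqs L v)))) : Gqs L v))
    (hexh : ∀ T ∈ SH, ∀ (s : ↥T), IsLocalGRegular L v (s : ((UnitaryGroup.cmDatum L 2 (Matrix.of fun i j : Fin 2 => if i.val + j.val + 1 = 2 then (1 : L) else 0)).Local v × (UnitaryGroup.cmDatum L 1 (Matrix.of fun i j : Fin 1 => if i.val + j.val + 1 = 1 then (1 : L) else 0)).Local v)) → ∀ γ' : Gqs L v, IsLocalNormPair L (qsForm L) v s.1 γ' →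
      ∃ i : Fin (n T), IsConj ((eT T i s : ↥(Subgroup.centralizer ({γc T i} : Set (Gqs L v)))) : Gqs L v) γ')
    (hinj : ∀ T ∈ SH, ∀ (s : ↥T), IsLocalGRegular L v (s : ((UnitaryGroup.cmDatum L 2 (Matrix.of fun i j : Fin 2 => if i.val + j.val + 1 = 2 then (1 : L) else 0)).Local v × (UnitaryGroup.cmDatum L 1 (Matrix.of fun i j : Fin 1 => if i.val + j.val + 1 = 1 then (1 : L) else 0)).Local v)) → ∀ i i' : Fin (n T), i ≠ i' →
      ¬ IsConj ((eT T i s : ↥(Subgroup.centralizer ({γc T i} : Set (Gqs L v)))) : Gqs L v) ((eT T i' s : ↥(Subgroup.centralizer ({γc T i'} : Set (Gqs L v)))) : Gqs L v))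
    (hZ : ∀ T ∈ SH, ∃ γ₀ : ((UnitaryGroup.cmDatum L 2 (Matrix.of fun i j : Fin 2 => if i.val + j.val + 1 = 2 then (1 : L) else 0)).Local v × (UnitaryGroup.cmDatum L 1 (Matrix.of fun i j : Fin 1 => if i.val + j.val + 1 = 1 then (1 : L) else 0)).Local v), IsLocalGRegular L v γ₀ ∧ T = Subgroup.centralizer ({γ₀} : Set ((UnitaryGroup.cmDatum L 2 (Matrix.of fun i j : Fin 2 => if i.val + j.val + 1 = 2 then (1 : L) else 0)).Local v × (UnitaryGroup.cmDatum L 1 (Matrix.of fun i j : Fin 1 => if i.val + j.val + 1 = 1 then (1 : L) else 0)).Local v)))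
    (hKH : ∀ T ∈ SH, IsCompact (T : Set ((UnitaryGroup.cmDatum L 2 (Matrix.of fun i j : Fin 2 => if i.val + j.val + 1 = 2 then (1 : L) else 0)).Local v × (UnitaryGroup.cmDatum L 1 (Matrix.of fun i j : Fin 1 => if i.val + j.val + 1 = 1 then (1 : L) else 0)).Local v)))
    (m : Subgroup ((UnitaryGroup.cmDatum L 2 (Matrix.of fun i j : Fin 2 => if i.val + j.val + 1 = 2 then (1 : L) else 0)).Local v × (UnitaryGroup.cmDatum L 1 (Matrix.of fun i j : Fin 1 => if i.val + j.val + 1 = 1 then (1 : L) else 0)).Local v) → ℕ)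
    (hclasses : ∀ T ∈ SH, ∀ s ∈ T, IsLocalGRegular L v s →
      ∃ C : Finset ((UnitaryGroup.cmDatum L 2 (Matrix.of fun i j : Fin 2 => if i.val + j.val + 1 = 2 then (1 : L) else 0)).Local v × (UnitaryGroup.cmDatum L 1 (Matrix.of fun i j : Fin 1 => if i.val + j.val + 1 = 1 then (1 : L) else 0)).Local v), (∀ x ∈ C, IsLocalStablyConjH L v s x) ∧ (∀ x ∈ C, ∀ y ∈ C, IsConj x y → x = y) ∧
        (∀ y, IsLocalStablyConjH L v s y → ∃ x ∈ C, IsConj y x) ∧ C.card = m T) :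
    ∀ T ∈ SH, n T = 2 * m T := by
  intro T hT
  obtain ⟨γ₀, hγ₀, hTeq⟩ := hZ T hT
  have hmem : γ₀ ∈ T := by
    rw [hTeq]
    exact Subgroup.mem_centralizer_iff.2 fun b hb => by rw [Set.mem_singleton_iff.1 hb]
  have hcpt : IsCompact ((Subgroup.centralizer ({γ₀} : Set ((UnitaryGroup.cmDatum L 2 (Matrix.of fun i j : Fin 2 => if i.val + j.val + 1 = 2 then (1 : L) else 0)).Local v × (UnitaryGroup.cmDatum L 1 (Matrix.of fun i j : Fin 1 => if i.val + j.val + 1 = 1 then (1 : L) else 0)).Local v)) : Subgroup ((UnitaryGroup.cmDatum L 2 (Matrix.of fun i j : Fin 2 => if i.val + j.val + 1 = 2 then (1 : L) else 0)).Local v × (UnitaryGroup.cmDatum L 1 (Matrix.of fun i j : Fin 1 => if i.val + j.val + 1 = 1 then (1 : L) else 0)).Local v)) : Set ((UnitaryGroup.cmDatum L 2 (Matrix.of fun i j : Fin 2 => if i.val + j.val + 1 = 2 then (1 : L) else 0)).Local v × (UnitaryGroup.cmDatum L 1 (Matrix.of fun i j : Fin 1 => if i.val + j.val + 1 = 1 then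 (1 : L) else 0)).Local v)) := by
    rw [← hTeq]; exact hKH T hT
  -- `n T` counts the `G`-classes over `ι_v(γ₀)`
  have hn : {c : ConjClasses (Gqs L v) | IsLocalNormPair L (qsForm L) v γ₀ (Quotient.out c)}.ncard = n T :=
    ncard_setOf_out_eq_of_fin_transversal (IsLocalNormPair L (qsForm L) v γ₀)
      (fun a b hab ha => isLocalNormPair_of_isConj_right' L v γ₀ hab ha)
      (fun i => ((eT T i ⟨γ₀, hmem⟩ : ↥(Subgroup.centralizer ({γc T i} : Set (Gqs L v)))) : Gqs L v))
      (fun i => heT T hT i ⟨γ₀, hmem⟩) (fun i j hij => hinj T hT ⟨γ₀, hmem⟩ hγ₀ i j hij) (fun a ha => hexh T hT ⟨γ₀, hmem⟩ hγ₀ a ha)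
  -- `m T` counts the `H_v`-classes in the stable class of `γ₀`
  obtain ⟨C, hCst, hCinj, hCexh, hCcard⟩ := hclasses T hT γ₀ hmem hγ₀
  have hm : {d : ConjClasses ((UnitaryGroup.cmDatum L 2 (Matrix.of fun i j : Fin 2 => if i.val + j.val + 1 = 2 then (1 : L) else 0)).Local v × (UnitaryGroup.cmDatum L 1 (Matrix.of fun i j : Fin 1 => if i.val + j.val + 1 = 1 then (1 : L) else 0)).Local v) | IsLocalStablyConjH L v γ₀ (Quotient.out d)}.ncard = m T := by
    rw [← hCcard]
    exact ncard_setOf_out_eq_card_of_finset_transversal (IsLocalStablyConjH L v) γ₀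
      (fun b b' hbb' hb => hb.trans (isStablyConjH_of_isConj hbb')) C hCst hCinj hCexh
  rw [← hn, ← hm]
  exact ncard_normPairClasses_eq_two_mul_ncard_stableClasses L v hns γ₀ hγ₀ hcpt

end CM

end Summit.HodgeConjecture.HodgeConjecture.Cruxes.H413.F0P3cStCharTSEllInnerIndexTwo

end
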